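import Literature.NumberTheory.Automorphic.FiniteAdeleSchwartzBruhatFourier
import Literature.NumberTheory.Automorphic.AdelicPoissonSummation
import Literature.NumberTheory.Automorphic.AdicCompletionCompact
import Literature.Analysis.Distribution.SchwartzFourierBilinForm
import Literature.Analysis.Distribution.SchwartzLatticeSum
import HarnessLib

/-!
# Schwartz–Bruhat functions on `𝔸_K^ι`: Poisson summation and stability under the Fourier transform

Topic `NumberTheory/Automorphic`; namespace `Literature.NumberTheory.Automorphic`. For a number
field `K` and a finite index type `ι` this file sets up the Schwartz–Bruhat space of the vector group
`𝔸_K^ι` (Weil's standard functions: finite sums of `Φ_∞ ⊗ Φ_f` with `Φ_∞` Schwartz on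
`(K ⊗ ℝ)^ι` and `Φ_f` locally constant of compact support on `(𝔸_K^∞)^ι`) and PROVES that it
satisfies the hypotheses of the adelic Poisson summation formula of `AdelicPoissonSummation` and is
stable under the Fourier transform — the analytic input of the functional equation / analytic
continuation of the global zeta integrals of Tate (`ι = 1`) and Godement–Jacquet (`M_n(𝔸) = 𝔸^{n²}`,
LNM 260, §11):

* `piArch`, `piFinite`, `piAdeleSplit` — the coordinates `𝔸_K^ι ≅ (K ⊗ ℝ)^ι × (𝔸_K^∞)^ι`
  (a `ContinuousAddEquiv`); `IsFactorizablePiSchwartzBruhat`, `piSchwartzBruhat K ι` — the space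
  `𝒮(𝔸_K^ι)`; `adelicPiFourier K ι ν Φ η = ∫ Φ(v) ψ(Σ_i η_i v_i) dν(v)` — the transform for Tate's
  character `ψ = adeleAddChar K`, whose values at rational `η = ξ ∈ K^ι` are the Fourier coefficients
  `piFourierCoeff ν Φ ξ` (`piFourierCoeff_eq_adelicPiFourier`, definitional).
* `piTracePairing`, `piTracePairing_nondegenerate` — the trace pairing `Σ_i Tr(a_i w_i)` of
  `(K ⊗ ℝ)^ι`; `piIntegerLattice` (discrete) and `exists_summable_forall_norm_schwartz_add_le` —
  lattice sums of a Schwartz function over the rational vectors of bounded denominator, locally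
  uniformly (`SchwartzLatticeSum`).
* `adeleAddChar_sum_mul_piAdeleSplit` — **the character splits**:
  `ψ(Σ η_i v_i) = exp(-2πi Σ Tr(a_i η_{i,∞})) ψ_f(Σ η_{i,f} b_i)` for `v = (a, b)`;
  `exists_haar_eq_smul_map_prod` — **a Haar measure on `𝔸_K^ι` is `c · split_*(μ_∞ ⊗ μ_f)`**;
  `adelicPiFourier_tensor` — the transform of `Φ_∞ ⊗ Φ_f` is `c · Φ̂_∞ ⊗ Φ̂_f` with `Φ̂_∞` the
  Fourier transform for the trace pairing (`SchwartzFourierBilinForm`) and `Φ̂_f = finitePiFourier`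
  (`FiniteAdeleSchwartzBruhatFourier`).
* For `Φ ∈ 𝒮(𝔸_K^ι)`: `continuous_of_mem_piSchwartzBruhat`, `integrable_of_mem_piSchwartzBruhat`
  (every Haar `ν`), `exists_summable_majorant_of_mem_piSchwartzBruhat` (locally uniform summable
  majorants of `ξ ↦ Φ(x + ξ)`), `summable_norm_of_mem_piSchwartzBruhat`,
  `summable_norm_adelicPiFourier_of_mem_piSchwartzBruhat`,
  **`adelicPiFourier_mem_piSchwartzBruhat`** (`𝒮` is stable under `Φ ↦ Φ̂`) and the
  **Poisson summation formula** `tsum_eq_inv_measure_mul_tsum_adelicPiFourier`: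
  `Σ_{ξ ∈ K^ι} Φ(ξ) = ν(D^ι)⁻¹ Σ_{ξ ∈ K^ι} Φ̂(ξ)`.

Everything is proved; no named facts. Measurable structures: `[MeasurableSpace 𝔸_K] [BorelSpace 𝔸_K]`
as in `AdelicPoissonSummation`; the finite-adelic σ-algebra used internally is `borel`.

## References

* J. Tate, *Fourier analysis in number fields and Hecke's zeta-functions*, in Cassels–Fröhlich
  (eds.), *Algebraic Number Theory* (1967), Ch. XV, §3.2–3.3, Thm. 4.2.1, Lemma 4.2.4
  [CasselsFrohlichANT1967].
* R. Godement, H. Jacquet, *Zeta functions of simple algebras*, LNM 260 (1972), §11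
  [GodementJacquetLNM260].
* A. Weil, *Basic Number Theory* (1967), Ch. VII §2 [WeilBNT1967].
-/

noncomputable section

open MeasureTheory MeasureTheory.Measure NumberField NumberField.InfinitePlace NumberField.mixedEmbedding
  IsDedekindDomain Filter Topology
open scoped SchwartzMap NNReal ENNReal FourierTransform Classical

namespace Literature.NumberTheory.Automorphic

/-! ### Archimedean and finite coordinates on `𝔸_K^ι` -/

section Coordinates

variable (K : Type) [Field K] [NumberField K] (ι : Type)

/-- The archimedean coordinates `𝔸_K^ι → (K ⊗ ℝ)^ι` in Mathlib's mixed-space model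
(`InfiniteAdeleRing.ringEquiv_mixedSpace` coordinatewise). [folklore] -/
def piArch (v : ι → AdeleRing (𝓞 K) K) : ι → mixedSpace K :=
  fun i => InfiniteAdeleRing.ringEquiv_mixedSpace K (v i).1

/-- The finite coordinates `𝔸_K^ι → (𝔸_K^∞)^ι`. [folklore] -/
def piFinite (v : ι → AdeleRing (𝓞 K) K) : ι → FiniteAdeleRing (𝓞 K) K :=
  fun i => (v i).2

variable {K ι}

/-- Unfolding of `piArch`. [folklore] -/
@[simp]
theorem piArch_apply (v : ι → AdeleRing (𝓞 K) K) (i : ι) :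
    piArch K ι v i = InfiniteAdeleRing.ringEquiv_mixedSpace K (v i).1 := rfl

/-- Unfolding of `piFinite`. [folklore] -/
@[simp]
theorem piFinite_apply (v : ι → AdeleRing (𝓞 K) K) (i : ι) : piFinite K ι v i = (v i).2 := rfl

/-- `piArch` is additive. [folklore] -/
theorem piArch_add (v w : ι → AdeleRing (𝓞 K) K) :
    piArch K ι (v + w) = piArch K ι v + piArch K ι w := by
  funext i
  simp only [piArch_apply, Pi.add_apply]
  rw [show (v i + w i).1 = (v i).1 + (w i).1 from rfl, map_add]

/-- `piFinite` is additive. [folklore] -/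
theorem piFinite_add (v w : ι → AdeleRing (𝓞 K) K) :
    piFinite K ι (v + w) = piFinite K ι v + piFinite K ι w := rfl

/-- `piArch` is continuous. [folklore] -/
theorem continuous_piArch : Continuous (piArch K ι) :=
  continuous_pi fun i => (continuous_ringEquiv_mixedSpace (K := K)).comp
    (continuous_fst.comp (continuous_apply i))

/-- `piFinite` is continuous. [folklore] -/
theorem continuous_piFinite : Continuous (piFinite K ι) :=
  continuous_pi fun i => continuous_snd.comp (continuous_apply i)

/-- The archimedean coordinates of a rational vector are its mixed embedding. [folklore] -/
theorem piArch_algebraMap (ξ : ι → K) :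
    piArch K ι (fun i => algebraMap K (AdeleRing (𝓞 K) K) (ξ i)) = fun i => mixedEmbedding K (ξ i) := by
  funext i
  rw [piArch_apply, InfiniteAdeleRing.mixedEmbedding_eq_algebraMap_comp]
  rfl

/-- The finite coordinates of a rational vector. [folklore] -/
theorem piFinite_algebraMap (ξ : ι → K) :
    piFinite K ι (fun i => algebraMap K (AdeleRing (𝓞 K) K) (ξ i)) =
      fun i => algebraMap K (FiniteAdeleRing (𝓞 K) K) (ξ i) := rfl

variable (K ι)

/-- **The splitting `𝔸_K^ι ≅ (K ⊗ ℝ)^ι × (𝔸_K^∞)^ι`** as an isomorphism of topological additive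
groups (`𝔸_K = K_∞ × 𝔸_K^∞` coordinatewise and `K_∞ ≅ K ⊗ ℝ`, Mathlib
`InfiniteAdeleRing.ringEquiv_mixedSpace`, continuous both ways by `AdelicGLnGlue`). [folklore] -/
def piAdeleSplit : (ι → mixedSpace K) × (ι → FiniteAdeleRing (𝓞 K) K) ≃ₜ+ (ι → AdeleRing (𝓞 K) K) where
  toFun p := fun i => ((InfiniteAdeleRing.ringEquiv_mixedSpace K).symm (p.1 i), p.2 i)
  invFun v := (piArch K ι v, piFinite K ι v)
  left_inv p := by
    refine Prod.ext (funext fun i => ?_) (funext fun _ => rfl)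
    exact (InfiniteAdeleRing.ringEquiv_mixedSpace K).apply_symm_apply _
  right_inv v := by
    funext i
    exact Prod.ext ((InfiniteAdeleRing.ringEquiv_mixedSpace K).symm_apply_apply _) rfl
  map_add' p q := by
    funext i
    refine Prod.ext ?_ ?_
    · change (InfiniteAdeleRing.ringEquiv_mixedSpace K).symm (p.1 i + q.1 i) = _
      rw [map_add]
      rfl
    · rfl
  continuous_toFun := by
    refine continuous_pi fun i => Continuous.prodMk ?_ ?_
    · exact (continuous_ringEquiv_mixedSpace_symm (K := K)).comp
        ((continuous_apply i).comp continuous_fst)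
    · exact (continuous_apply i).comp continuous_snd
  continuous_invFun := Continuous.prodMk continuous_piArch continuous_piFinite

variable {K ι}

/-- The inverse splitting is `(piArch, piFinite)` (definitional). [folklore] -/
@[simp]
theorem piAdeleSplit_symm_apply (v : ι → AdeleRing (𝓞 K) K) :
    (piAdeleSplit K ι).symm v = (piArch K ι v, piFinite K ι v) := rfl

/-- Archimedean components of the splitting. [folklore] -/
theorem piAdeleSplit_apply_fst (p : (ι → mixedSpace K) × (ι → FiniteAdeleRing (𝓞 K) K)) (i : ι) :
    (piAdeleSplit K ι p i).1 = (InfiniteAdeleRing.ringEquiv_mixedSpace K).symm (p.1 i) := rfl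

/-- Finite components of the splitting. [folklore] -/
theorem piAdeleSplit_apply_snd (p : (ι → mixedSpace K) × (ι → FiniteAdeleRing (𝓞 K) K)) (i : ι) :
    (piAdeleSplit K ι p i).2 = p.2 i := rfl

/-- `piArch ∘ split = fst`. [folklore] -/
@[simp]
theorem piArch_piAdeleSplit (p : (ι → mixedSpace K) × (ι → FiniteAdeleRing (𝓞 K) K)) :
    piArch K ι (piAdeleSplit K ι p) = p.1 :=
  funext fun _ => (InfiniteAdeleRing.ringEquiv_mixedSpace K).apply_symm_apply _

/-- `piFinite ∘ split = snd`. [folklore] -/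
@[simp]
theorem piFinite_piAdeleSplit (p : (ι → mixedSpace K) × (ι → FiniteAdeleRing (𝓞 K) K)) :
    piFinite K ι (piAdeleSplit K ι p) = p.2 := rfl

end Coordinates

/-! ### The Schwartz–Bruhat space of `𝔸_K^ι` -/

section SchwartzBruhatPi

variable (K : Type) [Field K] [NumberField K] (ι : Type) [Fintype ι]

/-- `Φ : 𝔸_K^ι → ℂ` is a **factorizable Schwartz–Bruhat function** `Φ = Φ_∞ ⊗ Φ_f`: `Φ_∞` a Schwartz
function on the real vector space `(K ⊗ ℝ)^ι` (Mathlib `SchwartzMap`, through `piArch`) and `Φ_f`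
locally constant of compact support on `(𝔸_K^∞)^ι` (`SchwartzBruhat` of `TateLocalFactors`).
(Weil's standard functions; Tate (1967), §3.2, §4.2; Godement–Jacquet, LNM 260, §11 on `M_n`.)
[folklore] -/
def IsFactorizablePiSchwartzBruhat (Φ : (ι → AdeleRing (𝓞 K) K) → ℂ) : Prop :=
  ∃ (Φinf : 𝓢((ι → mixedSpace K), ℂ)) (Φfin : (ι → FiniteAdeleRing (𝓞 K) K) → ℂ),
    Φfin ∈ SchwartzBruhat (ι → FiniteAdeleRing (𝓞 K) K) ∧
      Φ = fun v => Φinf (piArch K ι v) * Φfin (piFinite K ι v)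

/-- The **Schwartz–Bruhat space `𝒮(𝔸_K^ι) = 𝒮((K ⊗ ℝ)^ι) ⊗ 𝒮((𝔸_K^∞)^ι)`**: the `ℂ`-span of the
factorizable Schwartz–Bruhat functions. [folklore] -/
def piSchwartzBruhat : Submodule ℂ ((ι → AdeleRing (𝓞 K) K) → ℂ) :=
  Submodule.span ℂ {Φ | IsFactorizablePiSchwartzBruhat K ι Φ}

variable {K ι}

/-- Factorizable functions lie in the Schwartz–Bruhat space. [folklore] -/
theorem mem_piSchwartzBruhat {Φ : (ι → AdeleRing (𝓞 K) K) → ℂ}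
    (h : IsFactorizablePiSchwartzBruhat K ι Φ) : Φ ∈ piSchwartzBruhat K ι :=
  Submodule.subset_span h

/-- Pure tensors lie in the Schwartz–Bruhat space. [folklore] -/
theorem tensor_mem_piSchwartzBruhat (Φinf : 𝓢((ι → mixedSpace K), ℂ))
    {Φfin : (ι → FiniteAdeleRing (𝓞 K) K) → ℂ} (hfin : Φfin ∈ SchwartzBruhat (ι → FiniteAdeleRing (𝓞 K) K)) :
    (fun v => Φinf (piArch K ι v) * Φfin (piFinite K ι v)) ∈ piSchwartzBruhat K ι :=
  mem_piSchwartzBruhat ⟨Φinf, Φfin, hfin, rfl⟩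

variable (K ι)

/-- The **adelic Fourier transform on `𝔸_K^ι`** for the pairing `⟨η, v⟩ = Σ_i η_i v_i` and Tate's
character `ψ = adeleAddChar K`: `Φ̂(η) = ∫ Φ(v) ψ(Σ_i η_i v_i) dν(v)`, as a function of
`η ∈ 𝔸_K^ι`; at rational `η = ξ ∈ K^ι` it is the Fourier coefficient `piFourierCoeff ν Φ ξ` of
`AdelicPoissonSummation` (`piFourierCoeff_eq_adelicPiFourier`). [folklore] -/
def adelicPiFourier [MeasurableSpace (AdeleRing (𝓞 K) K)] (ν : Measure (ι → AdeleRing (𝓞 K) K))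
    (Φ : (ι → AdeleRing (𝓞 K) K) → ℂ) (η : ι → AdeleRing (𝓞 K) K) : ℂ :=
  ∫ v, Φ v * (adeleAddChar K (∑ i, η i * v i) : ℂ) ∂ν

variable {K ι}

/-- Unfolding of `adelicPiFourier`. [folklore] -/
theorem adelicPiFourier_apply [MeasurableSpace (AdeleRing (𝓞 K) K)]
    (ν : Measure (ι → AdeleRing (𝓞 K) K)) (Φ : (ι → AdeleRing (𝓞 K) K) → ℂ)
    (η : ι → AdeleRing (𝓞 K) K) :
    adelicPiFourier K ι ν Φ η = ∫ v, Φ v * (adeleAddChar K (∑ i, η i * v i) : ℂ) ∂ν := rfl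

/-- The Fourier coefficients of `AdelicPoissonSummation` are the values of the adelic Fourier
transform at rational vectors. [folklore] -/
theorem piFourierCoeff_eq_adelicPiFourier [MeasurableSpace (AdeleRing (𝓞 K) K)]
    (ν : Measure (ι → AdeleRing (𝓞 K) K)) (Φ : (ι → AdeleRing (𝓞 K) K) → ℂ) (ξ : ι → K) :
    piFourierCoeff ν Φ ξ =
      adelicPiFourier K ι ν Φ (fun i => algebraMap K (AdeleRing (𝓞 K) K) (ξ i)) := rfl

end SchwartzBruhatPi

/-! ### The trace pairing and the integer lattice of `(K ⊗ ℝ)^ι` -/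

section Lattice

variable (K : Type) [Field K] [NumberField K] (ι : Type) [Fintype ι]

/-- The **trace pairing** `⟨a, w⟩ = Σ_i Tr(a_i w_i)` on `(K ⊗ ℝ)^ι` (`Tr = mixedTrace K` the trace
form of the étale algebra `K ⊗ ℝ`, `AdelicAdditiveCharacterDuality`). [folklore] -/
def piTracePairing : LinearMap.BilinForm ℝ (ι → mixedSpace K) :=
  LinearMap.mk₂ ℝ (fun a w => ∑ i, mixedTrace K (a i * w i))
    (fun a a' w => by simp [add_mul, Finset.sum_add_distrib])
    (fun c a w => by simp [Finset.mul_sum])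
    (fun a w w' => by simp [mul_add, Finset.sum_add_distrib])
    (fun c a w => by simp [Finset.mul_sum])

variable {K ι}

/-- Unfolding of `piTracePairing`. [folklore] -/
theorem piTracePairing_apply (a w : ι → mixedSpace K) :
    piTracePairing K ι a w = ∑ i, mixedTrace K (a i * w i) := rfl

variable (K ι)

/-- The trace pairing on `(K ⊗ ℝ)^ι` is non-degenerate (coordinatewise
`tracePairing_nondegenerate`). [folklore] -/
theorem piTracePairing_nondegenerate : (piTracePairing K ι).Nondegenerate := by
  classical
  have hsymm : (piTracePairing K ι).IsSymm :=
    ⟨fun a w => by simp [piTracePairing_apply, mul_comm]⟩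
  refine hsymm.isRefl.nondegenerate_iff_separatingLeft.2 fun a ha => funext fun i => ?_
  have hnd := tracePairing_nondegenerate K
  refine (tracePairing_isSymm K).isRefl.nondegenerate_iff_separatingLeft.1 hnd (a i) fun y => ?_
  have h := ha (Pi.single i y)
  rw [piTracePairing_apply, Finset.sum_eq_single i (fun j _ hj => by
    rw [Pi.single_eq_of_ne hj, mul_zero, map_zero]) (fun hi => (hi (Finset.mem_univ i)).elim),
    Pi.single_eq_same] at h
  rw [tracePairing_apply]
  exact h

/-- The **integer lattice `(𝓞_K)^ι ⊆ (K ⊗ ℝ)^ι`** (coordinatewise Mathlib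
`mixedEmbedding.integerLattice K`). [folklore] -/
def piIntegerLattice : Submodule ℤ (ι → mixedSpace K) :=
  Submodule.pi Set.univ fun _ => mixedEmbedding.integerLattice K

variable {K ι}

omit [NumberField K] [Fintype ι] in
/-- Membership in the integer lattice: every coordinate is the image of a global integer.
[folklore] -/
theorem mem_piIntegerLattice_iff {a : ι → mixedSpace K} :
    a ∈ piIntegerLattice K ι ↔ ∀ i, ∃ r : 𝓞 K, mixedEmbedding K (r : K) = a i := by
  simp only [piIntegerLattice, Submodule.mem_pi, Set.mem_univ, true_implies]
  refine forall_congr' fun i => ?_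
  constructor
  · rintro ⟨r, hr⟩
    exact ⟨r, hr⟩
  · rintro ⟨r, hr⟩
    exact ⟨r, hr⟩

/-- The integer lattice of `(K ⊗ ℝ)^ι` is discrete (it embeds continuously and injectively into the
finite product of the discrete lattices `𝓞_K ⊆ K ⊗ ℝ`). [folklore] -/
instance instDiscreteTopologyPiIntegerLattice : DiscreteTopology (piIntegerLattice K ι) := by
  haveI : Finite ι := Finite.of_fintype ι
  let f : piIntegerLattice K ι → (ι → mixedEmbedding.integerLattice K) :=
    fun a i => ⟨(a : ι → mixedSpace K) i, by
      have := a.2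
      simp only [piIntegerLattice, Submodule.mem_pi, Set.mem_univ, true_implies] at this
      exact this i⟩
  have hf : Continuous f := continuous_pi fun i =>
    (((continuous_apply i).comp continuous_subtype_val)).subtype_mk _
  have hinj : Function.Injective f := by
    intro a b h
    refine Subtype.ext (funext fun i => ?_)
    have := congrArg (fun g => ((g i : mixedEmbedding.integerLattice K) : mixedSpace K)) h
    exact this
  exact DiscreteTopology.of_continuous_injective hf hinj

variable (K ι)

/-- Multiplication by the mixed embedding of a non-zero `d ∈ K`, coordinatewise, as a continuous
linear automorphism of `(K ⊗ ℝ)^ι`. [folklore] -/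
def mulArchCLE {d : K} (hd : d ≠ 0) : (ι → mixedSpace K) ≃L[ℝ] (ι → mixedSpace K) :=
  LinearEquiv.toContinuousLinearEquiv
    { toFun := fun a i => mixedEmbedding K d * a i
      invFun := fun a i => mixedEmbedding K d⁻¹ * a i
      map_add' := fun a b => funext fun i => by simp [mul_add]
      map_smul' := fun c a => funext fun i => by simp
      left_inv := fun a => funext fun i => by
        simp only
        rw [← mul_assoc, ← map_mul, inv_mul_cancel₀ hd, map_one, one_mul]
      right_inv := fun a => funext fun i => by
        simp only
        rw [← mul_assoc, ← map_mul, mul_inv_cancel₀ hd, map_one, one_mul] }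

variable {K ι}

/-- Unfolding of `mulArchCLE`. [folklore] -/
@[simp]
theorem mulArchCLE_apply {d : K} (hd : d ≠ 0) (a : ι → mixedSpace K) (i : ι) :
    mulArchCLE K ι hd a i = mixedEmbedding K d * a i := rfl

/-- **Lattice sums of a Schwartz function over the rational vectors with denominator `d`**, locally
uniformly: for `g ∈ 𝓢((K ⊗ ℝ)^ι)`, `d ∈ 𝓞 K ∖ 0` and a radius `R` there is a summable
`u : K^ι → ℝ≥0` with `|g(a + ξ)| ≤ u(ξ)` for all `|a| ≤ R` and all `ξ ∈ K^ι` with `d ξ ∈ (𝓞 K)^ι`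
(`SchwartzLatticeSum` for the Schwartz function `g ∘ (d⁻¹ ·)` and the lattice `(𝓞_K)^ι`, then
reindex along the injection `ξ ↦ d ξ`). [folklore] -/
theorem exists_summable_forall_norm_schwartz_add_le (g : 𝓢((ι → mixedSpace K), ℂ)) {d : 𝓞 K}
    (hd : d ≠ 0) (R : ℝ) :
    ∃ u : (ι → K) → ℝ, Summable u ∧ (∀ ξ, 0 ≤ u ξ) ∧
      ∀ a : ι → mixedSpace K, ‖a‖ ≤ R → ∀ ξ : ι → K, (∀ i, ∃ r : 𝓞 K, (r : K) = (d : K) * ξ i) →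
        ‖g (a + fun i => mixedEmbedding K (ξ i))‖ ≤ u ξ := by
  classical
  have hdK : (d : K) ≠ 0 := by exact_mod_cast hd
  set M := mulArchCLE K ι hdK with hM
  -- `g' = g ∘ M⁻¹`, a Schwartz function, and its lattice majorant on the ball of radius `‖M‖ R`
  set g' : 𝓢((ι → mixedSpace K), ℂ) := SchwartzMap.compCLMOfContinuousLinearEquiv ℂ M.symm g
    with hg'
  obtain ⟨U, hU, hUb⟩ := Literature.Analysis.Distribution.SchwartzMap.exists_summable_forall_norm_add_le
    (piIntegerLattice K ι) g' (‖(M : (ι → mixedSpace K) →L[ℝ] (ι → mixedSpace K))‖ * R)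
  -- extend `|U|` by zero to the ambient space
  set Ut : (ι → mixedSpace K) → ℝ :=
    Function.extend (Subtype.val : piIntegerLattice K ι → ι → mixedSpace K) (fun ℓ => |U ℓ|) 0
    with hUt
  have hUt_apply : ∀ ℓ : piIntegerLattice K ι, Ut (ℓ : ι → mixedSpace K) = |U ℓ| := fun ℓ =>
    Subtype.val_injective.extend_apply _ _ ℓ
  have hUt_zero : ∀ a : ι → mixedSpace K,
      a ∉ Set.range (Subtype.val : piIntegerLattice K ι → ι → mixedSpace K) → Ut a = 0 := by
    intro a ha
    rw [hUt, Function.extend_apply' _ _ _ fun h => ha (by obtain ⟨ℓ, rfl⟩ := h; exact ⟨ℓ, rfl⟩)]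
    rfl
  have hUt0 : ∀ a, 0 ≤ Ut a := fun a => by
    by_cases ha : a ∈ Set.range (Subtype.val : piIntegerLattice K ι → ι → mixedSpace K)
    · obtain ⟨ℓ, rfl⟩ := ha
      rw [hUt_apply]
      exact abs_nonneg _
    · rw [hUt_zero a ha]
  have hUts : Summable Ut := by
    refine (Subtype.val_injective.summable_iff hUt_zero).1 ?_
    have : Ut ∘ (Subtype.val : piIntegerLattice K ι → ι → mixedSpace K) = fun ℓ => |U ℓ| :=
      funext fun ℓ => hUt_apply ℓ
    rw [this]
    exact hU.abs
  -- reindex along the injection `ξ ↦ d ξ_∞`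
  set θ : (ι → K) → (ι → mixedSpace K) := fun ξ => M fun i => mixedEmbedding K (ξ i) with hθ
  have hθinj : Function.Injective θ := by
    intro ξ ξ' h
    have h' := M.injective h
    exact funext fun i => mixedEmbedding_injective K (congr_fun h' i)
  refine ⟨Ut ∘ θ, hUts.comp_injective hθinj, fun ξ => hUt0 _, fun a ha ξ hξ => ?_⟩
  choose r hr using hξ
  have hmem : θ ξ ∈ piIntegerLattice K ι := mem_piIntegerLattice_iff.2 fun i =>
    ⟨r i, by simp only [hθ, hM, mulArchCLE_apply, hr i, map_mul]⟩
  have h1 : g (a + fun i => mixedEmbedding K (ξ i)) = g' (M a + θ ξ) := by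
    rw [hg', SchwartzMap.compCLMOfContinuousLinearEquiv_apply, Function.comp_apply, hθ, ← map_add,
      ContinuousLinearEquiv.symm_apply_apply]
  have hMa : ‖M a‖ ≤ ‖(M : (ι → mixedSpace K) →L[ℝ] (ι → mixedSpace K))‖ * R :=
    ((M : (ι → mixedSpace K) →L[ℝ] (ι → mixedSpace K)).le_opNorm a).trans
      (mul_le_mul_of_nonneg_left ha (norm_nonneg _))
  calc ‖g (a + fun i => mixedEmbedding K (ξ i))‖ = ‖g' (M a + θ ξ)‖ := by rw [h1]
    _ ≤ U ⟨θ ξ, hmem⟩ := hUb (M a) hMa ⟨θ ξ, hmem⟩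
    _ ≤ |U ⟨θ ξ, hmem⟩| := le_abs_self _
    _ = Ut (θ ξ) := (hUt_apply ⟨θ ξ, hmem⟩).symm

end Lattice

/-! ### The character of `𝔸_K^ι` splits along `𝔸_K^ι ≅ (K ⊗ ℝ)^ι × (𝔸_K^∞)^ι` -/

section CharacterSplit

variable (K : Type) [Field K] [NumberField K] {ι : Type} [Fintype ι]

/-- `exp(2πi t)` in the two Mathlib spellings. [folklore] -/
theorem toCircle_coe_eq_fourierChar (t : ℝ) :
    AddCircle.toCircle ((t : ℝ) : AddCircle (1 : ℝ)) = 𝐞 t := by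
  rw [AddCircle.toCircle_apply_mk, Real.fourierChar_apply', div_one]

/-- **The archimedean component of Tate's character**: `ψ_K(y, 0) = exp(-2πi Tr_{K_∞/ℝ}(y))`.
[cite: CasselsFrohlichANT1967, Ch. XV (Tate), §2.2 ("note the minus sign!")] -/
theorem adeleAddChar_infiniteAdeleInl (y : InfiniteAdeleRing K) :
    adeleAddChar K (infiniteAdeleInl K y) = 𝐞 (-(infiniteAdeleTrace K y)) := by
  rw [adeleAddChar_apply_of_isFiniteIntegral K (x := infiniteAdeleInl K y) (fun v => zero_mem _),
    ← AddCircle.coe_neg, toCircle_coe_eq_fourierChar]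
  rfl

/-- Second components of finite sums of adeles. [folklore] -/
theorem AdeleRing.snd_sum {α : Type*} (s : Finset α) (f : α → AdeleRing (𝓞 K) K) :
    (∑ a ∈ s, f a).2 = ∑ a ∈ s, (f a).2 :=
  _root_.map_sum (AddMonoidHom.snd (InfiniteAdeleRing K) (FiniteAdeleRing (𝓞 K) K)) f s

/-- First components of finite sums of adeles. [folklore] -/
theorem AdeleRing.fst_sum {α : Type*} (s : Finset α) (f : α → AdeleRing (𝓞 K) K) :
    (∑ a ∈ s, f a).1 = ∑ a ∈ s, (f a).1 :=
  _root_.map_sum (AddMonoidHom.fst (InfiniteAdeleRing K) (FiniteAdeleRing (𝓞 K) K)) f s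

/-- **The character `ψ(Σ_i η_i v_i)` splits**: on `v = (a, b) ∈ (K ⊗ ℝ)^ι × (𝔸_K^∞)^ι`,
`ψ_K(Σ_i η_i v_i) = exp(-2πi Σ_i Tr(a_i η_{i,∞})) · ψ_f(Σ_i η_{i,f} b_i)`. [folklore] -/
theorem adeleAddChar_sum_mul_piAdeleSplit (η : ι → AdeleRing (𝓞 K) K)
    (p : (ι → mixedSpace K) × (ι → FiniteAdeleRing (𝓞 K) K)) :
    (adeleAddChar K (∑ i, η i * piAdeleSplit K ι p i) : ℂ) =
      (𝐞 (-(piTracePairing K ι p.1 (piArch K ι η))) : ℂ) *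
        (finiteAdeleAddChar K (∑ i, piFinite K ι η i * p.2 i) : ℂ) := by
  rw [adeleAddChar_eq_mul, Circle.coe_mul]
  congr 2
  · rw [adeleAddChar_infiniteAdeleInl]
    congr 2
    rw [AdeleRing.fst_sum, piTracePairing_apply, ← mixedTrace_ringEquiv_mixedSpace, _root_.map_sum,
      _root_.map_sum]
    refine Finset.sum_congr rfl fun i _ => ?_
    rw [show (η i * piAdeleSplit K ι p i).1 = (η i).1 * (piAdeleSplit K ι p i).1 from rfl,
      piAdeleSplit_apply_fst, map_mul, RingEquiv.apply_symm_apply, piArch_apply, mul_comm]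
  · congr 1
    rw [AdeleRing.snd_sum]
    rfl

end CharacterSplit

/-! ### Haar measure on `𝔸_K^ι` is a product -/

section ProductMeasure

attribute [local instance] secondCountableTopology_adeleRing locallyCompactSpace_adeleRing'
  secondCountableTopology_finiteAdeleRing locallyCompactSpace_finiteAdeleRing'

variable (K : Type) [Field K] [NumberField K] (ι : Type) [Fintype ι]
  [MeasurableSpace (AdeleRing (𝓞 K) K)] [BorelSpace (AdeleRing (𝓞 K) K)]
  [MeasurableSpace (FiniteAdeleRing (𝓞 K) K)] [BorelSpace (FiniteAdeleRing (𝓞 K) K)]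

/-- **An additive Haar measure on `𝔸_K^ι` is a positive multiple of the image of a product of Haar
measures on `(K ⊗ ℝ)^ι` and `(𝔸_K^∞)^ι`** under the splitting `piAdeleSplit` (uniqueness of Haar
measure; Tate (1967), §3.3, `dx = ∏ dx_v`). [folklore] -/
theorem exists_haar_eq_smul_map_prod (ν : Measure (ι → AdeleRing (𝓞 K) K)) [ν.IsAddHaarMeasure]
    (μE : Measure (ι → mixedSpace K)) [μE.IsAddHaarMeasure]
    (μf : Measure (ι → FiniteAdeleRing (𝓞 K) K)) [μf.IsAddHaarMeasure] :
    ∃ c : ℝ≥0, 0 < c ∧ ν = c • (μE.prod μf).map (piAdeleSplit K ι) := by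
  haveI : BorelSpace (ι → AdeleRing (𝓞 K) K) := Pi.borelSpace
  haveI : BorelSpace (ι → FiniteAdeleRing (𝓞 K) K) := Pi.borelSpace
  haveI : BorelSpace ((ι → mixedSpace K) × (ι → FiniteAdeleRing (𝓞 K) K)) := Prod.borelSpace
  haveI : (μE.prod μf).IsAddHaarMeasure := Measure.prod.instIsAddHaarMeasure μE μf
  haveI : ((μE.prod μf).map (piAdeleSplit K ι)).IsAddHaarMeasure :=
    (piAdeleSplit K ι).isAddHaarMeasure_map (μE.prod μf)
  exact ⟨ν.addHaarScalarFactor ((μE.prod μf).map (piAdeleSplit K ι)),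
    addHaarScalarFactor_pos_of_isAddHaarMeasure _ _, isAddLeftInvariant_eq_smul _ _⟩

variable {K ι}

/-- Integrals against `c · split_*(μ_∞ ⊗ μ_f)` are `c` times the double integral. [folklore] -/
theorem integral_eq_smul_integral_prod {ν : Measure (ι → AdeleRing (𝓞 K) K)}
    {μE : Measure (ι → mixedSpace K)} {μf : Measure (ι → FiniteAdeleRing (𝓞 K) K)} {c : ℝ≥0}
    (h : ν = c • (μE.prod μf).map (piAdeleSplit K ι)) (G : (ι → AdeleRing (𝓞 K) K) → ℂ) :
    ∫ v, G v ∂ν = (c : ℝ) • ∫ p, G (piAdeleSplit K ι p) ∂(μE.prod μf) := by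
  haveI : BorelSpace (ι → AdeleRing (𝓞 K) K) := Pi.borelSpace
  haveI : BorelSpace (ι → FiniteAdeleRing (𝓞 K) K) := Pi.borelSpace
  haveI : BorelSpace ((ι → mixedSpace K) × (ι → FiniteAdeleRing (𝓞 K) K)) := Prod.borelSpace
  rw [h, integral_smul_nnreal_measure, NNReal.smul_def,
    show (⇑(piAdeleSplit K ι) : _ → ι → AdeleRing (𝓞 K) K) =
      ⇑(piAdeleSplit K ι).toHomeomorph.toMeasurableEquiv by
        rw [Homeomorph.toMeasurableEquiv_coe]; rfl,
    integral_map_equiv]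

/-- Integrability against `c · split_*(μ_∞ ⊗ μ_f)`, `c ≠ 0`, is integrability of the pull-back
against the product measure. [folklore] -/
theorem integrable_iff_integrable_prod {ν : Measure (ι → AdeleRing (𝓞 K) K)}
    {μE : Measure (ι → mixedSpace K)} {μf : Measure (ι → FiniteAdeleRing (𝓞 K) K)} {c : ℝ≥0}
    (hc : 0 < c) (h : ν = c • (μE.prod μf).map (piAdeleSplit K ι))
    (G : (ι → AdeleRing (𝓞 K) K) → ℂ) :
    Integrable G ν ↔ Integrable (fun p => G (piAdeleSplit K ι p)) (μE.prod μf) := by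
  haveI : BorelSpace (ι → AdeleRing (𝓞 K) K) := Pi.borelSpace
  haveI : BorelSpace (ι → FiniteAdeleRing (𝓞 K) K) := Pi.borelSpace
  haveI : BorelSpace ((ι → mixedSpace K) × (ι → FiniteAdeleRing (𝓞 K) K)) := Prod.borelSpace
  rw [h, show ((c • (μE.prod μf).map (piAdeleSplit K ι) : Measure (ι → AdeleRing (𝓞 K) K))) =
      (c : ℝ≥0∞) • (μE.prod μf).map (piAdeleSplit K ι) from rfl,
    integrable_smul_measure (by exact_mod_cast hc.ne') ENNReal.coe_ne_top,
    show (⇑(piAdeleSplit K ι) : _ → ι → AdeleRing (𝓞 K) K) =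
      ⇑(piAdeleSplit K ι).toHomeomorph.toMeasurableEquiv by
        rw [Homeomorph.toMeasurableEquiv_coe]; rfl,
    integrable_map_equiv]
  rfl

end ProductMeasure

/-! ### Factorizable Schwartz–Bruhat functions: continuity, integrability, Fourier transform -/

section Factorizable

attribute [local instance] secondCountableTopology_adeleRing locallyCompactSpace_adeleRing'
  secondCountableTopology_finiteAdeleRing locallyCompactSpace_finiteAdeleRing'

variable (K : Type) [Field K] [NumberField K] (ι : Type) [Fintype ι]

variable {K ι} in
/-- Factorizable Schwartz–Bruhat functions are continuous. [folklore] -/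
theorem IsFactorizablePiSchwartzBruhat.continuous {Φ : (ι → AdeleRing (𝓞 K) K) → ℂ}
    (h : IsFactorizablePiSchwartzBruhat K ι Φ) : Continuous Φ := by
  obtain ⟨Φinf, Φfin, hfin, rfl⟩ := h
  exact (Φinf.continuous.comp continuous_piArch).mul
    (hfin.1.continuous.comp continuous_piFinite)

variable {K ι} in
/-- Denominator bookkeeping at one place: from `d₂ (y + k)` and `d₁ y` integral at `v` conclude that
`d₂ d₁ k` is integral at `v`. [folklore] -/
theorem coe_mul_mem_adicCompletionIntegers_of_denominators (v : HeightOneSpectrum (𝓞 K))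
    (y : FiniteAdeleRing (𝓞 K) K) (k : K) (d₁ d₂ : 𝓞 K)
    (h1 : (algebraMap (𝓞 K) (FiniteAdeleRing (𝓞 K) K) d₂ *
      (y + algebraMap K (FiniteAdeleRing (𝓞 K) K) k)) v ∈ v.adicCompletionIntegers K)
    (h2 : (algebraMap (𝓞 K) (FiniteAdeleRing (𝓞 K) K) d₁ * y) v ∈ v.adicCompletionIntegers K) :
    ((((d₂ * d₁ : 𝓞 K) : K) * k : K) : v.adicCompletion K) ∈ v.adicCompletionIntegers K := by
  set φ : FiniteAdeleRing (𝓞 K) K →+* v.adicCompletion K :=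
    RestrictedProduct.evalRingHom (fun w : HeightOneSpectrum (𝓞 K) => w.adicCompletion K) v
    with hφdef
  have hφ : ∀ z : FiniteAdeleRing (𝓞 K) K, z v = φ z := fun z => rfl
  have key : algebraMap K (FiniteAdeleRing (𝓞 K) K) (((d₂ * d₁ : 𝓞 K) : K) * k) =
      algebraMap (𝓞 K) (FiniteAdeleRing (𝓞 K) K) d₁ *
          (algebraMap (𝓞 K) (FiniteAdeleRing (𝓞 K) K) d₂ *
            (y + algebraMap K (FiniteAdeleRing (𝓞 K) K) k)) -
        algebraMap (𝓞 K) (FiniteAdeleRing (𝓞 K) K) d₂ *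
          (algebraMap (𝓞 K) (FiniteAdeleRing (𝓞 K) K) d₁ * y) := by
    rw [IsScalarTower.algebraMap_apply (𝓞 K) K (FiniteAdeleRing (𝓞 K) K) d₁,
      IsScalarTower.algebraMap_apply (𝓞 K) K (FiniteAdeleRing (𝓞 K) K) d₂]
    simp only [map_mul]
    ring
  have hv : (algebraMap K (FiniteAdeleRing (𝓞 K) K) (((d₂ * d₁ : 𝓞 K) : K) * k)) v = _ :=
    congrArg (fun z : FiniteAdeleRing (𝓞 K) K => z v) key
  change (algebraMap K (FiniteAdeleRing (𝓞 K) K) (((d₂ * d₁ : 𝓞 K) : K) * k)) v ∈ _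
  rw [hv, hφ, map_sub, map_mul, map_mul]
  rw [hφ] at h1 h2
  refine sub_mem (mul_mem ?_ h1) (mul_mem ?_ h2)
  · exact HeightOneSpectrum.coe_mem_adicCompletionIntegers v d₁
  · exact HeightOneSpectrum.coe_mem_adicCompletionIntegers v d₂

variable {K ι} in
/-- **Locally uniform summable majorants of the rational translates** (the hypothesis `hloc` of
`AdeleRing.pi_tsum_eq_inv_measure_mul_tsum_piFourierCoeff`) for a factorizable Schwartz–Bruhat
function: for `x` in a compact set, `Φ(x + ξ) ≠ 0` (`ξ ∈ K^ι`) forces `d ξ ∈ (𝓞 K)^ι` for a fixed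
`d ≠ 0` (compact support of the finite factor and a common denominator of the finite coordinates of
the compact set), and over such `ξ` the archimedean Schwartz factor is dominated by a summable
family, locally uniformly (`exists_summable_forall_norm_schwartz_add_le`). [folklore] -/
theorem IsFactorizablePiSchwartzBruhat.exists_summable_majorant {Φ : (ι → AdeleRing (𝓞 K) K) → ℂ}
    (h : IsFactorizablePiSchwartzBruhat K ι Φ) {C : Set (ι → AdeleRing (𝓞 K) K)}
    (hC : IsCompact C) :
    ∃ u : (ι → K) → ℝ, Summable u ∧ (∀ ξ, 0 ≤ u ξ) ∧
      ∀ x ∈ C, ∀ ξ : ι → K, ‖Φ (x + fun i => algebraMap K (AdeleRing (𝓞 K) K) (ξ i))‖ ≤ u ξ := by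
  obtain ⟨Φinf, Φfin, hfin, rfl⟩ := h
  -- a common denominator `d₁` of the finite coordinates of `C`
  set B : Set (FiniteAdeleRing (𝓞 K) K) :=
    ⋃ i : ι, (fun x : ι → AdeleRing (𝓞 K) K => (x i).2) '' C with hB
  have hBc : IsCompact B := isCompact_iUnion fun i =>
    hC.image (continuous_snd.comp (continuous_apply i))
  obtain ⟨d₁, hd₁, hd₁B⟩ := FiniteAdeleRing.exists_ne_zero_forall_mem_mul_mem (K := K) hBc
  -- a denominator `d₂` of the support of `Φ_f`
  obtain ⟨d₂, hd₂, hd₂S⟩ := exists_denominator_of_mem_schwartzBruhat K hfin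
  have hd : d₂ * d₁ ≠ 0 := mul_ne_zero hd₂ hd₁
  -- rational translates meeting the support have denominator `d₂ d₁`
  have hden : ∀ x ∈ C, ∀ ξ : ι → K,
      Φfin (piFinite K ι x + fun i => algebraMap K (FiniteAdeleRing (𝓞 K) K) (ξ i)) ≠ 0 →
        ∀ i, ∃ r : 𝓞 K, (r : K) = ((d₂ * d₁ : 𝓞 K) : K) * ξ i := by
    intro x hx ξ hne i
    refine exists_algebraMap_eq_of_forall_coe_mem (𝓞 K) K _ fun v => ?_
    have h1 := hd₂S _ hne i v
    have h2 := hd₁B ((x i).2) (by rw [hB]; exact Set.mem_iUnion.2 ⟨i, x, hx, rfl⟩) v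
    exact coe_mul_mem_adicCompletionIntegers_of_denominators v ((x i).2) (ξ i) d₁ d₂ h1 h2
  -- a bound for the archimedean coordinates of `C` and for `Φ_f`
  obtain ⟨R, hR⟩ := (hC.image continuous_piArch).isBounded.exists_norm_le
  obtain ⟨M, hM⟩ := hfin.2.exists_bound_of_continuous hfin.1.continuous
  -- the archimedean majorant
  obtain ⟨u, hu, hu0, hub⟩ := exists_summable_forall_norm_schwartz_add_le Φinf hd R
  refine ⟨fun ξ => max M 0 * u ξ, hu.mul_left _, fun ξ => mul_nonneg (le_max_right _ _) (hu0 ξ),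
    fun x hx ξ => ?_⟩
  beta_reduce
  rw [piArch_add, piFinite_add, piArch_algebraMap, piFinite_algebraMap, norm_mul]
  by_cases hz : Φfin (piFinite K ι x + fun i => algebraMap K (FiniteAdeleRing (𝓞 K) K) (ξ i)) = 0
  · rw [hz, norm_zero, mul_zero]
    exact mul_nonneg (le_max_right _ _) (hu0 ξ)
  · rw [mul_comm]
    refine mul_le_mul ((hM _).trans (le_max_left _ _))
      (hub _ (hR _ (Set.mem_image_of_mem _ hx)) ξ (hden x hx ξ hz)) (norm_nonneg _)
      (le_max_right _ _)

variable [MeasurableSpace (AdeleRing (𝓞 K) K)] [BorelSpace (AdeleRing (𝓞 K) K)]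
  (ν : Measure (ι → AdeleRing (𝓞 K) K)) [ν.IsAddHaarMeasure]

omit [ν.IsAddHaarMeasure] in
/-- **The transform of a pure tensor is the product of the transforms**: with
`ν = c · split_*(μ_∞ ⊗ μ_f)`,
`(Φ_∞ ⊗ Φ_f)^(η) = c · (∫ exp(-2πi⟨a, η_∞⟩) Φ_∞(a) dμ_∞(a)) · Φ̂_f(η_f)`. [folklore] -/
theorem adelicPiFourier_tensor [MeasurableSpace (FiniteAdeleRing (𝓞 K) K)]
    [BorelSpace (FiniteAdeleRing (𝓞 K) K)] (Φinf : 𝓢((ι → mixedSpace K), ℂ))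
    (Φfin : (ι → FiniteAdeleRing (𝓞 K) K) → ℂ) {μE : Measure (ι → mixedSpace K)} [SFinite μE]
    {μf : Measure (ι → FiniteAdeleRing (𝓞 K) K)} [SFinite μf] {c : ℝ≥0}
    (hν : ν = c • (μE.prod μf).map (piAdeleSplit K ι)) (η : ι → AdeleRing (𝓞 K) K) :
    adelicPiFourier K ι ν (fun v => Φinf (piArch K ι v) * Φfin (piFinite K ι v)) η =
      (c : ℂ) * (∫ a, 𝐞 (-(piTracePairing K ι a (piArch K ι η))) • Φinf a ∂μE) *
        finitePiFourier K μf Φfin (piFinite K ι η) := by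
  rw [adelicPiFourier_apply, integral_eq_smul_integral_prod hν, finitePiFourier_apply]
  have hint : (fun p : (ι → mixedSpace K) × (ι → FiniteAdeleRing (𝓞 K) K) =>
      Φinf (piArch K ι (piAdeleSplit K ι p)) * Φfin (piFinite K ι (piAdeleSplit K ι p)) *
        (adeleAddChar K (∑ i, η i * piAdeleSplit K ι p i) : ℂ)) =
      fun p => ((𝐞 (-(piTracePairing K ι p.1 (piArch K ι η))) : ℂ) * Φinf p.1) *
        (Φfin p.2 * (finiteAdeleAddChar K (∑ i, piFinite K ι η i * p.2 i) : ℂ)) := by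
    funext p
    rw [piArch_piAdeleSplit, piFinite_piAdeleSplit, adeleAddChar_sum_mul_piAdeleSplit]
    ring
  rw [hint, integral_prod_mul (fun a : ι → mixedSpace K =>
      ((𝐞 (-(piTracePairing K ι a (piArch K ι η))) : ℂ) * Φinf a))
    (fun b : ι → FiniteAdeleRing (𝓞 K) K =>
      Φfin b * (finiteAdeleAddChar K (∑ i, piFinite K ι η i * b i) : ℂ)),
    Complex.real_smul, mul_assoc]
  congr 2

variable {K ι ν} in
/-- Factorizable Schwartz–Bruhat functions are integrable for every additive Haar measure on `𝔸_K^ι`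
(Fubini along `𝔸_K^ι ≅ (K ⊗ ℝ)^ι × (𝔸_K^∞)^ι`: a Schwartz function is integrable, and so is a locally
constant compactly supported one). [folklore] -/
theorem IsFactorizablePiSchwartzBruhat.integrable {Φ : (ι → AdeleRing (𝓞 K) K) → ℂ}
    (h : IsFactorizablePiSchwartzBruhat K ι Φ) : Integrable Φ ν := by
  obtain ⟨Φinf, Φfin, hfin, rfl⟩ := h
  letI : MeasurableSpace (FiniteAdeleRing (𝓞 K) K) := borel _
  haveI : BorelSpace (FiniteAdeleRing (𝓞 K) K) := ⟨rfl⟩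
  haveI : BorelSpace (ι → FiniteAdeleRing (𝓞 K) K) := Pi.borelSpace
  haveI : BorelSpace (ι → mixedSpace K) := Pi.borelSpace
  set μE : Measure (ι → mixedSpace K) := Measure.addHaar with hμE
  set μf : Measure (ι → FiniteAdeleRing (𝓞 K) K) := Measure.addHaar with hμf
  obtain ⟨c, hc, hν⟩ := exists_haar_eq_smul_map_prod K ι ν μE μf
  rw [integrable_iff_integrable_prod hc hν]
  have : (fun p : (ι → mixedSpace K) × (ι → FiniteAdeleRing (𝓞 K) K) =>
      Φinf (piArch K ι (piAdeleSplit K ι p)) * Φfin (piFinite K ι (piAdeleSplit K ι p))) =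
      fun p => Φinf p.1 * Φfin p.2 := by
    funext p
    rw [piArch_piAdeleSplit, piFinite_piAdeleSplit]
  rw [this]
  exact Φinf.integrable.mul_prod (integrable_of_mem_schwartzBruhat K μf hfin)

variable {K ι ν} in
/-- **The Fourier transform of a factorizable Schwartz–Bruhat function is a factorizable
Schwartz–Bruhat function** (`SchwartzFourierBilinForm` for the archimedean factor and the trace
pairing, `finitePiFourier_mem_schwartzBruhat` for the finite factor). Tate (1967), §3.2, §4.2;
Godement–Jacquet, LNM 260, §11 (`𝒮(M_n(𝔸))` is stable under `Φ ↦ Φ̂`). [folklore] -/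
theorem IsFactorizablePiSchwartzBruhat.isFactorizable_adelicPiFourier
    {Φ : (ι → AdeleRing (𝓞 K) K) → ℂ}
    (h : IsFactorizablePiSchwartzBruhat K ι Φ) :
    IsFactorizablePiSchwartzBruhat K ι (adelicPiFourier K ι ν Φ) := by
  obtain ⟨Φinf, Φfin, hfin, rfl⟩ := h
  letI : MeasurableSpace (FiniteAdeleRing (𝓞 K) K) := borel _
  haveI : BorelSpace (FiniteAdeleRing (𝓞 K) K) := ⟨rfl⟩
  haveI : BorelSpace (ι → FiniteAdeleRing (𝓞 K) K) := Pi.borelSpace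
  haveI : BorelSpace (ι → mixedSpace K) := Pi.borelSpace
  set μE : Measure (ι → mixedSpace K) := Measure.addHaar with hμE
  set μf : Measure (ι → FiniteAdeleRing (𝓞 K) K) := Measure.addHaar with hμf
  obtain ⟨c, -, hν⟩ := exists_haar_eq_smul_map_prod K ι ν μE μf
  obtain ⟨g, hg⟩ :=
    Literature.Analysis.Distribution.SchwartzMap.exists_eq_integral_fourierChar_bilinForm μE
      (piTracePairing K ι) (piTracePairing_nondegenerate K ι) Φinf
  refine ⟨(c : ℂ) • g, finitePiFourier K μf Φfin, finitePiFourier_mem_schwartzBruhat K μf hfin,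
    funext fun η => ?_⟩
  rw [adelicPiFourier_tensor K ι ν Φinf Φfin hν, _root_.smul_apply, hg, smul_eq_mul]

variable {K ι ν} in
/-- **Summability of the Fourier coefficients** (the hypothesis `hsum` of the Poisson summation
formula) for a factorizable Schwartz–Bruhat function: `Σ_{ξ ∈ K^ι} |Φ̂(ξ)| < ∞` (the finite factor
of `Φ̂(ξ)` vanishes unless `e ξ ∈ (𝓞 K)^ι`, `exists_denominator_finitePiFourier_algebraMap`, and is
bounded by `∫ |Φ_f|`; the archimedean factor is a Schwartz function, summable over that lattice).
[folklore] -/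
theorem IsFactorizablePiSchwartzBruhat.summable_norm_adelicPiFourier
    {Φ : (ι → AdeleRing (𝓞 K) K) → ℂ} (h : IsFactorizablePiSchwartzBruhat K ι Φ) :
    Summable fun ξ : ι → K =>
      ‖adelicPiFourier K ι ν Φ (fun i => algebraMap K (AdeleRing (𝓞 K) K) (ξ i))‖ := by
  obtain ⟨Φinf, Φfin, hfin, rfl⟩ := h
  letI : MeasurableSpace (FiniteAdeleRing (𝓞 K) K) := borel _
  haveI : BorelSpace (FiniteAdeleRing (𝓞 K) K) := ⟨rfl⟩
  haveI : BorelSpace (ι → FiniteAdeleRing (𝓞 K) K) := Pi.borelSpace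
  haveI : BorelSpace (ι → mixedSpace K) := Pi.borelSpace
  set μE : Measure (ι → mixedSpace K) := Measure.addHaar with hμE
  set μf : Measure (ι → FiniteAdeleRing (𝓞 K) K) := Measure.addHaar with hμf
  obtain ⟨c, -, hν⟩ := exists_haar_eq_smul_map_prod K ι ν μE μf
  obtain ⟨g, hg⟩ :=
    Literature.Analysis.Distribution.SchwartzMap.exists_eq_integral_fourierChar_bilinForm μE
      (piTracePairing K ι) (piTracePairing_nondegenerate K ι) Φinf
  obtain ⟨e, he, hsupp⟩ := exists_denominator_finitePiFourier_algebraMap K μf hfin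
  obtain ⟨u, hu, hu0, hub⟩ := exists_summable_forall_norm_schwartz_add_le g he 0
  set M : ℝ := ∫ b, ‖Φfin b‖ ∂μf with hMdef
  have hM0 : 0 ≤ M := integral_nonneg fun _ => norm_nonneg _
  refine Summable.of_nonneg_of_le (fun _ => norm_nonneg _) (fun ξ => ?_) ((hu.mul_left ((c : ℝ) * M)))
  rw [adelicPiFourier_tensor K ι ν Φinf Φfin hν, ← hg, piArch_algebraMap, piFinite_algebraMap,
    norm_mul, norm_mul, Complex.norm_real, NNReal.norm_eq]
  by_cases hz : finitePiFourier K μf Φfin (fun i => algebraMap K (FiniteAdeleRing (𝓞 K) K) (ξ i)) = 0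
  · rw [hz, norm_zero, mul_zero]
    exact mul_nonneg (mul_nonneg c.2 hM0) (hu0 ξ)
  · have hgξ : ‖g fun i => mixedEmbedding K (ξ i)‖ ≤ u ξ := by
      have := hub 0 (by rw [norm_zero]) ξ (hsupp ξ hz)
      rwa [zero_add] at this
    have hfξ : ‖finitePiFourier K μf Φfin fun i => algebraMap K (FiniteAdeleRing (𝓞 K) K) (ξ i)‖ ≤ M :=
      norm_finitePiFourier_le K μf Φfin _
    calc (c : ℝ) * ‖g fun i => mixedEmbedding K (ξ i)‖ *
          ‖finitePiFourier K μf Φfin fun i => algebraMap K (FiniteAdeleRing (𝓞 K) K) (ξ i)‖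
        ≤ (c : ℝ) * u ξ * M :=
          mul_le_mul (mul_le_mul_of_nonneg_left hgξ c.2) hfξ (norm_nonneg _)
            (mul_nonneg c.2 (hu0 ξ))
      _ = (c : ℝ) * M * u ξ := by ring

end Factorizable

/-! ### The Schwartz–Bruhat space: Poisson summation and stability under the Fourier transform -/

section Main

attribute [local instance] secondCountableTopology_adeleRing locallyCompactSpace_adeleRing'
  secondCountableTopology_finiteAdeleRing locallyCompactSpace_finiteAdeleRing'

variable (K : Type) [Field K] [NumberField K] (ι : Type) [Fintype ι]

variable {K ι} in
/-- Continuity and locally uniform summable majorants of the rational translates, for every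
`Φ ∈ 𝒮(𝔸_K^ι)` (from the factorizable case by linearity). [folklore] -/
theorem continuous_and_exists_summable_majorant_of_mem_piSchwartzBruhat
    {Φ : (ι → AdeleRing (𝓞 K) K) → ℂ} (hΦ : Φ ∈ piSchwartzBruhat K ι) :
    Continuous Φ ∧ ∀ C : Set (ι → AdeleRing (𝓞 K) K), IsCompact C →
      ∃ u : (ι → K) → ℝ, Summable u ∧ (∀ ξ, 0 ≤ u ξ) ∧
        ∀ x ∈ C, ∀ ξ : ι → K, ‖Φ (x + fun i => algebraMap K (AdeleRing (𝓞 K) K) (ξ i))‖ ≤ u ξ := by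
  induction hΦ using Submodule.span_induction with
  | mem Φ h => exact ⟨h.continuous, fun C hC => h.exists_summable_majorant hC⟩
  | zero =>
    exact ⟨continuous_const, fun C _ => ⟨0, summable_zero, fun _ => le_rfl, fun x _ ξ => by simp⟩⟩
  | add Φ Ψ _ _ ihΦ ihΨ =>
    refine ⟨ihΦ.1.add ihΨ.1, fun C hC => ?_⟩
    obtain ⟨u₁, hu₁, hu₁0, hb₁⟩ := ihΦ.2 C hC
    obtain ⟨u₂, hu₂, hu₂0, hb₂⟩ := ihΨ.2 C hC
    refine ⟨u₁ + u₂, hu₁.add hu₂, fun ξ => add_nonneg (hu₁0 ξ) (hu₂0 ξ), fun x hx ξ => ?_⟩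
    exact (norm_add_le _ _).trans (add_le_add (hb₁ x hx ξ) (hb₂ x hx ξ))
  | smul a Φ _ ih =>
    refine ⟨ih.1.const_smul a, fun C hC => ?_⟩
    obtain ⟨u, hu, hu0, hb⟩ := ih.2 C hC
    refine ⟨fun ξ => ‖a‖ * u ξ, hu.mul_left _, fun ξ => mul_nonneg (norm_nonneg _) (hu0 ξ),
      fun x hx ξ => ?_⟩
    rw [Pi.smul_apply, _root_.norm_smul]
    exact mul_le_mul_of_nonneg_left (hb x hx ξ) (norm_nonneg _)

variable {K ι} in
/-- Schwartz–Bruhat functions on `𝔸_K^ι` are continuous. [folklore] -/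
theorem continuous_of_mem_piSchwartzBruhat {Φ : (ι → AdeleRing (𝓞 K) K) → ℂ}
    (hΦ : Φ ∈ piSchwartzBruhat K ι) : Continuous Φ :=
  (continuous_and_exists_summable_majorant_of_mem_piSchwartzBruhat hΦ).1

variable {K ι} in
/-- **`Σ_{ξ ∈ K^ι} |Φ(x + ξ)|` has summable majorants locally uniformly in `x`**, for
`Φ ∈ 𝒮(𝔸_K^ι)`. [folklore] -/
theorem exists_summable_majorant_of_mem_piSchwartzBruhat {Φ : (ι → AdeleRing (𝓞 K) K) → ℂ}
    (hΦ : Φ ∈ piSchwartzBruhat K ι) {C : Set (ι → AdeleRing (𝓞 K) K)} (hC : IsCompact C) :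
    ∃ u : (ι → K) → ℝ, Summable u ∧
      ∀ x ∈ C, ∀ ξ : ι → K, ‖Φ (x + fun i => algebraMap K (AdeleRing (𝓞 K) K) (ξ i))‖ ≤ u ξ := by
  obtain ⟨u, hu, -, hb⟩ := (continuous_and_exists_summable_majorant_of_mem_piSchwartzBruhat hΦ).2 C hC
  exact ⟨u, hu, hb⟩

variable {K ι} in
/-- **`Σ_{ξ ∈ K^ι} |Φ(ξ)| < ∞`** for `Φ ∈ 𝒮(𝔸_K^ι)`. [folklore] -/
theorem summable_norm_of_mem_piSchwartzBruhat {Φ : (ι → AdeleRing (𝓞 K) K) → ℂ}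
    (hΦ : Φ ∈ piSchwartzBruhat K ι) :
    Summable fun ξ : ι → K => ‖Φ fun i => algebraMap K (AdeleRing (𝓞 K) K) (ξ i)‖ := by
  obtain ⟨u, hu, hb⟩ := exists_summable_majorant_of_mem_piSchwartzBruhat hΦ isCompact_singleton
  refine Summable.of_nonneg_of_le (fun _ => norm_nonneg _) (fun ξ => ?_) hu
  simpa using hb 0 (Set.mem_singleton 0) ξ

variable [MeasurableSpace (AdeleRing (𝓞 K) K)] [BorelSpace (AdeleRing (𝓞 K) K)]
  (ν : Measure (ι → AdeleRing (𝓞 K) K)) [ν.IsAddHaarMeasure]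

omit [BorelSpace (AdeleRing (𝓞 K) K)] [ν.IsAddHaarMeasure] in
/-- The transform of `0` is `0`. [folklore] -/
theorem adelicPiFourier_zero : adelicPiFourier K ι ν 0 = 0 := by
  funext η
  simp [adelicPiFourier_apply]

omit [ν.IsAddHaarMeasure] in
/-- The transform is additive on integrable functions. [folklore] -/
theorem adelicPiFourier_add {Φ Ψ : (ι → AdeleRing (𝓞 K) K) → ℂ} (hΦ : Integrable Φ ν)
    (hΨ : Integrable Ψ ν) :
    adelicPiFourier K ι ν (Φ + Ψ) = adelicPiFourier K ι ν Φ + adelicPiFourier K ι ν Ψ := by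
  haveI : BorelSpace (ι → AdeleRing (𝓞 K) K) := Pi.borelSpace
  funext η
  simp only [adelicPiFourier_apply, Pi.add_apply, add_mul]
  have hc : Continuous fun v : ι → AdeleRing (𝓞 K) K =>
      (adeleAddChar K (∑ i, η i * v i) : ℂ) :=
    continuous_subtype_val.comp ((continuous_adeleAddChar K).comp
      (continuous_finsetSum _ fun i _ => continuous_const.mul (continuous_apply i)))
  have hb : ∀ v : ι → AdeleRing (𝓞 K) K, ‖(adeleAddChar K (∑ i, η i * v i) : ℂ)‖ ≤ 1 :=
    fun v => by rw [Circle.norm_coe]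
  exact integral_add (hΦ.mul_bdd hc.aestronglyMeasurable (ae_of_all _ hb))
    (hΨ.mul_bdd hc.aestronglyMeasurable (ae_of_all _ hb))

omit [BorelSpace (AdeleRing (𝓞 K) K)] [ν.IsAddHaarMeasure] in
/-- The transform is homogeneous. [folklore] -/
theorem adelicPiFourier_smul (a : ℂ) (Φ : (ι → AdeleRing (𝓞 K) K) → ℂ) :
    adelicPiFourier K ι ν (a • Φ) = a • adelicPiFourier K ι ν Φ := by
  funext η
  simp only [adelicPiFourier_apply, Pi.smul_apply, smul_eq_mul, mul_assoc, integral_const_mul]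

variable {K ι ν} in
/-- Integrability, summability of the Fourier coefficients, and stability of `𝒮(𝔸_K^ι)` under the
transform, for every `Φ ∈ 𝒮(𝔸_K^ι)` (from the factorizable case by linearity). [folklore] -/
theorem integrable_and_summable_and_mem_of_mem_piSchwartzBruhat
    {Φ : (ι → AdeleRing (𝓞 K) K) → ℂ} (hΦ : Φ ∈ piSchwartzBruhat K ι) :
    Integrable Φ ν ∧
      (Summable fun ξ : ι → K =>
        ‖adelicPiFourier K ι ν Φ (fun i => algebraMap K (AdeleRing (𝓞 K) K) (ξ i))‖) ∧
      adelicPiFourier K ι ν Φ ∈ piSchwartzBruhat K ι := by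
  induction hΦ using Submodule.span_induction with
  | mem Φ h =>
    exact ⟨h.integrable, h.summable_norm_adelicPiFourier,
      mem_piSchwartzBruhat h.isFactorizable_adelicPiFourier⟩
  | zero =>
    refine ⟨integrable_zero _ _ _, ?_, ?_⟩
    · simp only [adelicPiFourier_zero, Pi.zero_apply, norm_zero]
      exact summable_zero
    · rw [adelicPiFourier_zero]
      exact zero_mem _
  | add Φ Ψ _ _ ihΦ ihΨ =>
    refine ⟨ihΦ.1.add ihΨ.1, ?_, ?_⟩
    · rw [adelicPiFourier_add K ι ν ihΦ.1 ihΨ.1]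
      refine Summable.of_nonneg_of_le (fun _ => norm_nonneg _) (fun ξ => ?_) (ihΦ.2.1.add ihΨ.2.1)
      exact norm_add_le _ _
    · rw [adelicPiFourier_add K ι ν ihΦ.1 ihΨ.1]
      exact add_mem ihΦ.2.2 ihΨ.2.2
  | smul a Φ _ ih =>
    refine ⟨ih.1.smul a, ?_, ?_⟩
    · rw [adelicPiFourier_smul]
      simp only [Pi.smul_apply, _root_.norm_smul]
      exact ih.2.1.mul_left _
    · rw [adelicPiFourier_smul]
      exact Submodule.smul_mem _ _ ih.2.2

variable {K ι ν} in
/-- Schwartz–Bruhat functions are integrable for every additive Haar measure on `𝔸_K^ι`.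
[folklore] -/
theorem integrable_of_mem_piSchwartzBruhat {Φ : (ι → AdeleRing (𝓞 K) K) → ℂ}
    (hΦ : Φ ∈ piSchwartzBruhat K ι) : Integrable Φ ν :=
  (integrable_and_summable_and_mem_of_mem_piSchwartzBruhat hΦ).1

variable {K ι ν} in
/-- **`Σ_{ξ ∈ K^ι} |Φ̂(ξ)| < ∞`** for `Φ ∈ 𝒮(𝔸_K^ι)`. [folklore] -/
theorem summable_norm_adelicPiFourier_of_mem_piSchwartzBruhat {Φ : (ι → AdeleRing (𝓞 K) K) → ℂ}
    (hΦ : Φ ∈ piSchwartzBruhat K ι) :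
    Summable fun ξ : ι → K =>
      ‖adelicPiFourier K ι ν Φ (fun i => algebraMap K (AdeleRing (𝓞 K) K) (ξ i))‖ :=
  (integrable_and_summable_and_mem_of_mem_piSchwartzBruhat hΦ).2.1

variable {K ι ν} in
/-- **The Schwartz–Bruhat space `𝒮(𝔸_K^ι)` is stable under the Fourier transform** (Tate (1967),
§3.2 and §4.2; Godement–Jacquet, LNM 260, §11 for `M_n(𝔸)`; Weil, *Basic Number Theory*, VII §2).
[cite: CasselsFrohlichANT1967, Ch. XV (Tate), §4.2] -/
theorem adelicPiFourier_mem_piSchwartzBruhat {Φ : (ι → AdeleRing (𝓞 K) K) → ℂ}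
    (hΦ : Φ ∈ piSchwartzBruhat K ι) : adelicPiFourier K ι ν Φ ∈ piSchwartzBruhat K ι :=
  (integrable_and_summable_and_mem_of_mem_piSchwartzBruhat hΦ).2.2

variable {K ι ν} in
/-- **Poisson summation for Schwartz–Bruhat functions on `𝔸_K^ι`** (Tate's Lemma 4.2.4 / Riemann–Roch
theorem 4.2.1 for the vector group, in Tate's unnormalised form with an arbitrary Haar measure `ν`
and the Tate domain `D^ι = piFundamentalDomain K ι`): for `Φ ∈ 𝒮(𝔸_K^ι)`,
`Σ_{ξ ∈ K^ι} Φ(ξ) = ν(D^ι)⁻¹ Σ_{ξ ∈ K^ι} Φ̂(ξ)`, both sides converging absolutely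
(`summable_norm_of_mem_piSchwartzBruhat`, `summable_norm_adelicPiFourier_of_mem_piSchwartzBruhat`).
The hypotheses of `AdeleRing.pi_tsum_eq_inv_measure_mul_tsum_piFourierCoeff` are supplied by this
file. (Godement–Jacquet, LNM 260, §11, use it on `M_n(𝔸) = 𝔸^{n²}`.)
[cite: CasselsFrohlichANT1967, Ch. XV (Tate), Lemma 4.2.4] -/
theorem tsum_eq_inv_measure_mul_tsum_adelicPiFourier {Φ : (ι → AdeleRing (𝓞 K) K) → ℂ}
    (hΦ : Φ ∈ piSchwartzBruhat K ι) :
    ∑' ξ : ι → K, Φ (fun i => algebraMap K (AdeleRing (𝓞 K) K) (ξ i)) =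
      (ν (piFundamentalDomain K ι)).toReal⁻¹ *
        ∑' ξ : ι → K, adelicPiFourier K ι ν Φ (fun i => algebraMap K (AdeleRing (𝓞 K) K) (ξ i)) :=
  AdeleRing.pi_tsum_eq_inv_measure_mul_tsum_piFourierCoeff K ι ν
    (continuous_of_mem_piSchwartzBruhat hΦ) (integrable_of_mem_piSchwartzBruhat hΦ)
    (fun _ hC => exists_summable_majorant_of_mem_piSchwartzBruhat hΦ hC)
    (summable_norm_adelicPiFourier_of_mem_piSchwartzBruhat hΦ)

end Main

end Literature.NumberTheory.Automorphic
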